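import Summits.BirchSwinnertonDyer.BirchSwinnertonDyer.Theorems.AlignedTransportAtTwoMainConjectureOfRankZeroBSDAtTwoCubicChevalleyLValueBit
import Summits.BirchSwinnertonDyer.BirchSwinnertonDyer.Theorems.AlignedTransportAtTwoMainConjectureOfRankZeroBSDAtTwoCubicKilfordPrimes
import Summits.BirchSwinnertonDyer.BirchSwinnertonDyer.Theorems.AlignedTransportAtTwoOffStratumPartitionTwistFamilySmallSeeds
import Summits.BirchSwinnertonDyer.Rank1Residual.Additive.IntModelTamagawaCertificate
import Literature.NumberTheory.EllipticCurves.ComplexMultiplicationTwistIsogenyProofs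
import Literature.NumberTheory.EllipticCurves.ComplexMultiplicationRationalJIntegralProofs
import HarnessLib

/-!
# Route `AlignedTransportAtTwo`, crux C2 `MainConjectureOfRankZeroBSDAtTwo` (stmt-BirchSwinnertonDyer-22298):
# THE FIRST ROW OF THE CUBIC CHEVALLEY ROAD — `MC₂(307b1)` from PRINT + ONE `L`-VALUE BIT, every other binder kernel-decided

HONEST FRAMING (cell `bsd-f1-sign2`, WIDTH-5 attached prover seat `bsd-line-att-p5` gen 31 on line `birth` of the lead `bsd-line-att-p2`;
`--supports` stmt-BirchSwinnertonDyer-22298, closes nothing; BSD is NOT proved by any of this; the crux C2, its verdict «blocked-on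
`Rank1Residual.GreenbergMuConjectureIrreducible`» and every registered stub are untouched). THEOREMS ONLY (no definition, no instance,
no named fact, no `sorry`); the curve is written LITERALLY throughout (no abbreviation), as in `ByReductionTypeAtTwoSupersingularRung5021a`.

THE SEED. Cremona's (1992 Table 1 label) `307B1 = [1, 1, 0, 0, −1]`, `y² + xy = x³ + x² − 1`: `N = 307` (prime), `Δ_min = −307 ≡ 5 (mod 8)`
(OFF the Kilford stratum, `2 = 𝔭₁𝔭₂` in `ℚ(β)` with `f(𝔭₂) = 2`), `a₂ = +1` (good ORDINARY), `E(ℚ)_tors = 0`, `E[2]` irreducible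
(the `u`-cubic `u³ + 5u² − 64` has no root mod `7`), `c₃₀₇ = 1` (`I₁`, split: nodal root `111`), rank `0`, `L(E,1)/Ω = 1`, `#Ш_an = 1`
(Cremona 1992 Table 1 / Table 4, `307 B`; Hecke eigenvalues `a₂,a₅,a₇,a₁₁ = 1,0,3,5` of Table 3 re-computed by point counting). It is the first
curve of the sub-cell {good ordinary at `2`, `E(ℚ)[2] = 0`, `Δ < 0`, off the stratum, `∏ c_v` odd, `r_an = 0`} on the ODD-`L/Ω` branch whose
cubic `2`-torsion field `ℚ(β)` (discriminant `−307`) has a unit of `2`-adic sign `−1`: `ε₀ = (u² − 3u)/8`, `u = 4β`,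
`ε₀³ − 5ε₀² + 19ε₀ + 1 = 0`, and under `u ↦ e` (the odd `2`-adic root, `e ≡ 59 (mod 64)`) `ε₀ ↦ 3304/8 ≡ 5 (mod 8)`.
(The four other odd-branch seeds of conductor `≤ 1000` found in the table — `537D1`, `121A1`, `121C1`, `913A1` — all have sign `+1`;
see the crux workfile `ODD-BRANCH-att-p5-g31.md`.)

WHAT.
* §1 kernel-decided curve data: `Δ`, `c₄`, ellipticity, global minimality, `#Ẽ(𝔽₂) = 2` (good ordinary), `E[2]` irreducible / no rational
  `2`-torsion abscissa, `Δ_min = −307 ≡ 5 (mod 8)` (off the stratum), `Δ < 0`, `N = 307`, `∏ c_v` odd (Tate row certificate), non-CM.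
* §2 `BSD(307b1, 2)` from Creutz–Miller 2012 Thm. 1.1 (`N < 5000`, rank `= r_an = 0` via GZK) — tree named fact `bsdTriple_of_rank_le_one_of_conductor_lt`.
* §3 the unit certificate: the cubic unit equation of `ε₀ = P(4β)/8`, `P = X² − 3X`, in `ℚ(β)` (one `linear_combination` against `ψ_W(β) = 0`),
  and the integer congruences `64 ∣ c_W(59)`, `P(59) ≡ 8·5 (mod 64)`.
* §4 ★ `mazurMainConjecture_two_307b1_of_lValue`: **`MC₂(307b1)` ⟸ PRINT⁵ {Kato 17.4 (1)(2) at `2`, Greenberg 4.1, period unit, modularity, GZK} +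
  Creutz–Miller + `hYY` (Brumer–Kramer/Yoo–Yu) + MuIneqʳ (the registered stub, verbatim) + `r_an(307b1) = 0` + ONE table datum
  «`L(307b1,1)/Ω = q`, `ord₂ q = 0`» (Cremona: `q = 1`)** — att-p5 g30's door `…CubicChevalleyLValueBit.…_of_lValue_unit_of_unitCerts_muFree`
  with every other binder discharged in the kernel; `…_of_lValue_eq_one` the `q = 1` form; `classicalMuVanishes_cubicField_307b1_of_lValue`:
  `μ₂ = 0` for the cyclotomic `ℤ₂`-extension of `ℚ(β)` from `hYY` + Creutz–Miller + GZK + `r_an = 0` + the same datum.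

CONDITIONAL theorems (PRINT⁵, Creutz–Miller, `hYY`, MuIneqʳ and two certificates `r_an = 0`, `L/Ω` odd displayed); nothing is closed;
BSD is not proved; beyond-print theorem: no.

References: [CremonaAlgorithms1997] Table 1, 3, 4 (`307 B`); [CreutzMiller2012] Thm. 1.1; [YooYu2022] Thm. 1.6 with 1.4 / 1.10 / 1.11 (1), Lemma 4.11;
[Kato2004Asterisque] Thm. 17.4; [GreenbergLNM1716] Thm. 4.1; [Miller2011LMS] Def. 1.1; [SilvermanAEC2009] III.1, VII.1, VII.5; [Silverman1994] IV.9.4, IV.10.2;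
[Serre1973] II §3.3; tree: att-p5 g29 `…CubicChevalleyUnitSign(Doors)`, g30 `…SelmerTwoOfBSDp` / `…CubicChevalleyLValueBit`, att-p4 `…TwistFamilySmallSeeds`,
bsd-2adic `ByReductionTypeAtTwoTowerClassKit`, b2b `Rank2ObservatoryTamagawa*` / `IntModelTamagawaCertificate`.
-/

set_option linter.dupNamespace false
set_option autoImplicit false

noncomputable section

open scoped Classical NumberField nonZeroDivisors IntermediateField

namespace Summit.BirchSwinnertonDyer.BirchSwinnertonDyer.Theorems.AlignedTransportAtTwoCubicChevalleyRow307b1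

open NumberField IsDedekindDomain Polynomial WeierstrassCurve IntermediateField CongruenceSubgroup
  Literature.NumberTheory.IwasawaTheory Literature.NumberTheory.GaloisRepresentations
  Literature.NumberTheory.EllipticCurves Literature.NumberTheory.EllipticCurves.Greenberg1999
  Literature.NumberTheory.EllipticCurves.ModularForms Literature.NumberTheory.EllipticCurves.Rank1Residual
  Literature.NumberTheory.EllipticCurves.Module Literature.NumberTheory.EllipticCurves.Zhai2016
  Summit.BirchSwinnertonDyer.Rank1Residual Summit.BirchSwinnertonDyer.Rank1Residual.X1.MuLambda
  Summit.BirchSwinnertonDyer.Rank1Residual.X5 Summit.BirchSwinnertonDyer.Rank1Residual.X5.O1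
  Summit.BirchSwinnertonDyer.Rank1Residual.X5.Instances Summit.BirchSwinnertonDyer.Rank1Residual.F1Sign2
  Summit.BirchSwinnertonDyer.BirchSwinnertonDyer.Theorems.Rank1ResidualX1Defs
  Summit.BirchSwinnertonDyer.BirchSwinnertonDyer.Theses.AlignedTransportAtTwo
  Summit.BirchSwinnertonDyer.BirchSwinnertonDyer.Rank2Observatory.Tam
  Summit.BirchSwinnertonDyer.Rank1Residual.Additive.IntModelTam
  Summit.BirchSwinnertonDyer.BirchSwinnertonDyer.Theorems.AlignedTransportAtTwoCubicChevalleyLValueBit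
  Summit.BirchSwinnertonDyer.BirchSwinnertonDyer.Theorems.AlignedTransportAtTwoSelmerTwoOfBSDp
open Summit.BirchSwinnertonDyer.BirchSwinnertonDyer.Theorems.AlignedTransportAtTwoCubicKilfordPrimes (psi_gen_eq_zero)
open Summit.BirchSwinnertonDyer.BirchSwinnertonDyer.Theorems.AlignedTransportAtTwoKilfordStratumShared
  (not_onKilfordStratumAtTwo_iff_minimalDiscriminantInt_emod_eight_ne)

/-! ## §1 The curve `307b1 = [1, 1, 0, 0, −1]` — kernel-decided invariants -/

/-- `Δ(307b1) = −307` (minus a prime). [cite: CremonaAlgorithms1997, Table 1] -/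
theorem M307b1_Δ : (⟨1, 1, 0, 0, -1⟩ : WeierstrassCurve ℤ).Δ = -307 := by decide

/-- `c₄(307b1) = 25`. [cite: CremonaAlgorithms1997, Table 1] -/
theorem M307b1_c₄ : (⟨1, 1, 0, 0, -1⟩ : WeierstrassCurve ℤ).c₄ = 25 := by decide

/-- `307b1` is an elliptic curve (`Δ = −307 ≠ 0`). [cite: CremonaAlgorithms1997, Table 1] -/
theorem isElliptic_307b1 : ((⟨1, 1, 0, 0, -1⟩ : WeierstrassCurve ℤ).baseChange ℚ).IsElliptic := by
  rw [WeierstrassCurve.isElliptic_iff, baseChange_int_Δ, M307b1_Δ]; norm_num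

/-- Cremona's model `307b1` is globally minimal (`gcd(Δ, c₄) = 1`). [cite: SilvermanAEC2009, VII.1 Remark 1.1] -/
theorem isGloballyMinimal_307b1 : ((⟨1, 1, 0, 0, -1⟩ : WeierstrassCurve ℤ).baseChange ℚ).IsGloballyMinimal :=
  isGloballyMinimal_baseChange_int_of_gcd_eq_one 1 1 0 0 (-1) (by decide)

/-- `Δ(307b1)` and `c₄(307b1)` are coprime (semistable model). [cite: SilvermanAEC2009, VII.5 Prop. 5.1 (b)] -/
theorem M307b1_coprime : IsCoprime (⟨1, 1, 0, 0, -1⟩ : WeierstrassCurve ℤ).Δ (⟨1, 1, 0, 0, -1⟩ : WeierstrassCurve ℤ).c₄ := by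
  rw [M307b1_Δ, M307b1_c₄, Int.isCoprime_iff_gcd_eq_one]; decide

/-- **`N(307b1) = 307`** (semistable: `N = rad Δ`). [cite: Silverman1994, IV.10.2 (a),(b)] [cite: CremonaAlgorithms1997, Table 1] -/
theorem conductorNorm_307b1 [((⟨1, 1, 0, 0, -1⟩ : WeierstrassCurve ℤ).baseChange ℚ).IsElliptic] :
    ((⟨1, 1, 0, 0, -1⟩ : WeierstrassCurve ℤ).baseChange ℚ).conductorNorm ℤ = 307 := by
  refine conductorNorm_baseChange_int_of_isCoprime (⟨1, 1, 0, 0, -1⟩ : WeierstrassCurve ℤ) M307b1_coprime (k := 1) ?_ ?_ ?_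
  · exact (show Nat.Prime 307 by norm_num).prime.squarefree
  · rw [M307b1_Δ]; norm_num
  · rw [M307b1_Δ]; norm_num

/-- `307b1 mod 2` is `y² + xy = x³ + x² + 1`. [folklore] -/
theorem M307b1_mod_two : (⟨1, 1, 0, 0, -1⟩ : WeierstrassCurve ℤ).map (Int.castRingHom (ZMod 2)) = ⟨1, 1, 0, 0, 1⟩ := by
  ext <;> decide

/-- `#Ẽ(𝔽₂) = 2` for `307b1` (points `O`, `(0,1)`): `a₂ = 3 − 2 = +1`. [cite: CremonaAlgorithms1997, Table 3] -/
theorem M307b1_card_two :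
    Nat.card ((⟨1, 1, 0, 0, -1⟩ : WeierstrassCurve ℤ).map (Int.castRingHom (ZMod 2))).toAffine.Point = 2 := by
  rw [M307b1_mod_two, natCard_point_eq_one_add_card _ (by decide)]; decide

/-- **`307b1` has good ORDINARY reduction at `2`** (`2 ∤ Δ`, `#Ẽ(𝔽₂) = 2`). [cite: SilvermanAEC2009, VII.5 Prop. 5.1 (a)] -/
theorem goodOrd_two_307b1 [((⟨1, 1, 0, 0, -1⟩ : WeierstrassCurve ℤ).baseChange ℚ).IsElliptic]
    [((⟨1, 1, 0, 0, -1⟩ : WeierstrassCurve ℤ).baseChange ℚ).IsGloballyMinimal] :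
    GoodOrd ((⟨1, 1, 0, 0, -1⟩ : WeierstrassCurve ℤ).baseChange ℚ) 2 :=
  goodOrd_two_baseChange_int_of_card_two _ (by rw [M307b1_Δ]; decide) M307b1_card_two

/-- The coefficients of `307b1 / ℚ` (unfolded). [cite: CremonaAlgorithms1997, Table 1] -/
theorem c307b1_eq : (⟨1, 1, 0, 0, -1⟩ : WeierstrassCurve ℤ).baseChange ℚ = ⟨1, 1, 0, 0, -1⟩ := by
  rw [baseChange_int_eq]; norm_num

/-- `b₂, b₄, b₆` of `307b1`: `5, 0, −4`. [cite: SilvermanAEC2009, III.1] -/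
theorem c307b1_b : ((⟨1, 1, 0, 0, -1⟩ : WeierstrassCurve ℤ).baseChange ℚ).b₂ = ((5 : ℤ) : ℚ) ∧
    ((⟨1, 1, 0, 0, -1⟩ : WeierstrassCurve ℤ).baseChange ℚ).b₄ = ((0 : ℤ) : ℚ) ∧
    ((⟨1, 1, 0, 0, -1⟩ : WeierstrassCurve ℤ).baseChange ℚ).b₆ = ((-4 : ℤ) : ℚ) := by
  rw [c307b1_eq]; simp only [WeierstrassCurve.b₂, WeierstrassCurve.b₄, WeierstrassCurve.b₆]; norm_num

/-- **`E[2]` irreducible for `307b1`**: the monic `u`-cubic `u³ + 5u² − 64` has no root modulo `7`.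
[cite: SilvermanAEC2009, III.2.3 (b)] -/
theorem irr_two_307b1 [((⟨1, 1, 0, 0, -1⟩ : WeierstrassCurve ℤ).baseChange ℚ).IsElliptic] :
    Irr ((⟨1, 1, 0, 0, -1⟩ : WeierstrassCurve ℤ).baseChange ℚ) 2 :=
  irr_two_of_forall_cubic_ne _ c307b1_b.1 c307b1_b.2.1 c307b1_b.2.2 (ℓ := 7) (by decide)

/-- No rational `2`-torsion abscissa on `307b1` (the route's `ht` binder). [cite: SilvermanAEC2009, III.2.3 (b)] -/
theorem not_hasRationalTwoTorsionX_307b1 [((⟨1, 1, 0, 0, -1⟩ : WeierstrassCurve ℤ).baseChange ℚ).IsElliptic] :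
    ∀ x : ℚ, ¬ HasRationalTwoTorsionX ((⟨1, 1, 0, 0, -1⟩ : WeierstrassCurve ℤ).baseChange ℚ) x := by
  intro x hx
  exact (O1.irr_two_iff_not_exists_addOrderOf_eq_two _).mp irr_two_307b1 (exists_point_addOrderOf_eq_two hx)

/-- `Δ_min(307b1) = −307`. [cite: CremonaAlgorithms1997, Table 1] -/
theorem minimalDiscriminantInt_307b1 [((⟨1, 1, 0, 0, -1⟩ : WeierstrassCurve ℤ).baseChange ℚ).IsGloballyMinimal] :
    ((⟨1, 1, 0, 0, -1⟩ : WeierstrassCurve ℤ).baseChange ℚ).minimalDiscriminantInt = -307 := by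
  rw [Instances.minimalDiscriminantInt_baseChange_int, M307b1_Δ]

/-- **`307b1` is OFF the Kilford stratum** (`Δ_min ≡ 5 ≢ 1 (mod 8)`; good ordinary at `2`). [cite: Serre1973, Ch. II §3.3 Thm. 4] -/
theorem not_onKilfordStratumAtTwo_307b1 [((⟨1, 1, 0, 0, -1⟩ : WeierstrassCurve ℤ).baseChange ℚ).IsElliptic]
    [((⟨1, 1, 0, 0, -1⟩ : WeierstrassCurve ℤ).baseChange ℚ).IsGloballyMinimal] :
    ¬ OnKilfordStratumAtTwo ((⟨1, 1, 0, 0, -1⟩ : WeierstrassCurve ℤ).baseChange ℚ) :=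
  (not_onKilfordStratumAtTwo_iff_minimalDiscriminantInt_emod_eight_ne _ goodOrd_two_307b1).mpr
    (by rw [minimalDiscriminantInt_307b1]; decide)

/-- `Δ(307b1) < 0` (one real root of the `2`-division cubic). [cite: CremonaAlgorithms1997, Table 1] -/
theorem Δ_307b1_neg : ((⟨1, 1, 0, 0, -1⟩ : WeierstrassCurve ℤ).baseChange ℚ).Δ < 0 := by
  rw [baseChange_int_Δ, M307b1_Δ]; norm_num

/-- Tate's algorithm ROW CERTIFICATE of `307b1`: the one bad prime `307` (`⌊√307⌋ = 17`) is SPLIT multiplicative of type `I₁`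
(node-tangent root `w = 111`), `c₃₀₇ = 1`. [cite: Silverman1994, IV.9.4 Step 2] -/
theorem tamRowCheck_307b1 :
    TamLocal.rowCheck [⟨307, 17, 1, 111, 0, 0, 0, 1, 0, 0, 1⟩] (⟨1, 1, 0, 0, -1⟩ : WeierstrassCurve ℤ) = true := by
  decide +kernel

/-- **`2 ∤ ∏ c_ℓ(307b1)`** (indeed `∏ c_ℓ = c₃₀₇ = 1`), from the row certificate. [cite: Silverman1994, IV.9.4 Step 2] -/
theorem not_two_dvd_tamagawaProduct_307b1 [((⟨1, 1, 0, 0, -1⟩ : WeierstrassCurve ℤ).baseChange ℚ).IsGloballyMinimal] :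
    ¬ 2 ∣ ((⟨1, 1, 0, 0, -1⟩ : WeierstrassCurve ℤ).baseChange ℚ).tamagawaProduct :=
  not_dvd_tamagawaProduct_of_intModel_of_rowCheck
    (Literature.NumberTheory.EllipticCurves.integralModelInt_baseChange_int (⟨1, 1, 0, 0, -1⟩ : WeierstrassCurve ℤ))
    tamRowCheck_307b1 2 (by decide)

/-- **`∏ c_ℓ(307b1)` is odd** (the door's `htam` binder). [cite: Silverman1994, IV.9.4 Step 2] -/
theorem odd_tamagawaProduct_307b1 [((⟨1, 1, 0, 0, -1⟩ : WeierstrassCurve ℤ).baseChange ℚ).IsGloballyMinimal] :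
    Odd ((⟨1, 1, 0, 0, -1⟩ : WeierstrassCurve ℤ).baseChange ℚ).tamagawaProduct :=
  Nat.odd_iff.mpr (Nat.two_dvd_ne_zero.mp not_two_dvd_tamagawaProduct_307b1)

/-- **`307b1` has no complex multiplication**: `j = 25³/(−307)` is not an integer. [cite: SilvermanAEC2009, App. C §11] -/
theorem not_hasCM_307b1 [((⟨1, 1, 0, 0, -1⟩ : WeierstrassCurve ℤ).baseChange ℚ).IsElliptic] :
    ¬ ((⟨1, 1, 0, 0, -1⟩ : WeierstrassCurve ℤ).baseChange ℚ).HasCM := fun hCM ↦ by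
  obtain ⟨n, hn⟩ := ((⟨1, 1, 0, 0, -1⟩ : WeierstrassCurve ℤ).baseChange ℚ).exists_intCast_eq_j_of_hasCM hCM
  rw [j_eq_c₄_pow_div, baseChange_int_c₄, baseChange_int_Δ, M307b1_c₄, M307b1_Δ] at hn
  have h : (n : ℚ) * (-307) = 25 ^ 3 := by
    rw [hn]; push_cast; field_simp
  have h' : n * (-307) = 25 ^ 3 := by exact_mod_cast h
  omega

/-! ## §2 `BSD(307b1, 2)` from Creutz–Miller 2012 Thm. 1.1 (`N = 307 < 5000`, rank `= r_an = 0`) -/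

/-- **`BSD(307b1, 2)`** modulo PRINT {Creutz–Miller 2012 Thm. 1.1 (`hCM`), GZK (`hGZK`)} + the certificate `r_an(307b1) = 0`.
[cite: CreutzMiller2012, Thm. 1.1] [cite: Miller2011LMS, Def. 1.1] -/
theorem bsdp_two_307b1_of_creutzMiller [((⟨1, 1, 0, 0, -1⟩ : WeierstrassCurve ℤ).baseChange ℚ).IsElliptic]
    [((⟨1, 1, 0, 0, -1⟩ : WeierstrassCurve ℤ).baseChange ℚ).IsGloballyMinimal]
    (hCM : bsdTriple_of_rank_le_one_of_conductor_lt) (hGZK : rank_eq_analyticRank_of_analyticRank_le_one)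
    (hr : ((⟨1, 1, 0, 0, -1⟩ : WeierstrassCurve ℤ).baseChange ℚ).analyticRank = 0) :
    BSDp ((⟨1, 1, 0, 0, -1⟩ : WeierstrassCurve ℤ).baseChange ℚ) 2 :=
  forall_bsdp_of_bsdTriple _ (tamagawaProduct_pos_holds _)
    (hCM _ (by rw [(hGZK _ (by omega)).1]; omega) (by rw [conductorNorm_307b1]; norm_num)) 2 Nat.prime_two

/-! ## §3 The unit certificate of `ℚ(β)` (discriminant `−307`): `ε₀ = (u² − 3u)/8`, `u = 4β` -/

/-- **The cubic unit equation in `ℚ(β)`**: with `P = X² − 3X`, `k = 3`, `m = 1`, the element `ε₀ = P(4β)/8` satisfies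
`ε₀³ − 5ε₀² + 19ε₀ + 1 = 0` (so `ε₀ ∈ (𝓞ℚ(β))ˣ`, norm `−1`) — one `linear_combination` against `ψ_W(β) = 4β³ + 5β² − 4 = 0`
with multiplier `2β³ − 7β² + (57/8)β − 1/4`. [cite: SilvermanAEC2009, III.1] [cite: Lang1990, Ch. 13 §4] -/
theorem unit_eq_307b1 {β : AlgebraicClosure ℚ}
    (hβ : aeval β ((⟨1, 1, 0, 0, -1⟩ : WeierstrassCurve ℤ).baseChange ℚ).twoTorsionPolynomial.toPoly = 0) :
    (aeval (4 * (AdjoinSimple.gen ℚ β : ↥(IntermediateField.adjoin ℚ ({β} : Set (AlgebraicClosure ℚ)))))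
          (((X ^ 2 - 3 * X : ℤ[X])).map (Int.castRingHom ℚ)) /
          (2 ^ (3 : ℕ) * ((1 : ℤ) : ↥(IntermediateField.adjoin ℚ ({β} : Set (AlgebraicClosure ℚ)))))) ^ 3
        - ((5 : ℤ) : ↥(IntermediateField.adjoin ℚ ({β} : Set (AlgebraicClosure ℚ)))) *
          (aeval (4 * (AdjoinSimple.gen ℚ β : ↥(IntermediateField.adjoin ℚ ({β} : Set (AlgebraicClosure ℚ)))))
          (((X ^ 2 - 3 * X : ℤ[X])).map (Int.castRingHom ℚ)) /
          (2 ^ (3 : ℕ) * ((1 : ℤ) : ↥(IntermediateField.adjoin ℚ ({β} : Set (AlgebraicClosure ℚ)))))) ^ 2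
        + ((19 : ℤ) : ↥(IntermediateField.adjoin ℚ ({β} : Set (AlgebraicClosure ℚ)))) *
          (aeval (4 * (AdjoinSimple.gen ℚ β : ↥(IntermediateField.adjoin ℚ ({β} : Set (AlgebraicClosure ℚ)))))
          (((X ^ 2 - 3 * X : ℤ[X])).map (Int.castRingHom ℚ)) /
          (2 ^ (3 : ℕ) * ((1 : ℤ) : ↥(IntermediateField.adjoin ℚ ({β} : Set (AlgebraicClosure ℚ))))))
        - ((-1 : ℤ) : ↥(IntermediateField.adjoin ℚ ({β} : Set (AlgebraicClosure ℚ)))) = 0 := by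
  have hψ := psi_gen_eq_zero ((⟨1, 1, 0, 0, -1⟩ : WeierstrassCurve ℤ).baseChange ℚ) hβ
  rw [c307b1_b.1, c307b1_b.2.1, c307b1_b.2.2] at hψ
  set g : ↥(IntermediateField.adjoin ℚ ({β} : Set (AlgebraicClosure ℚ))) := AdjoinSimple.gen ℚ β with hg
  simp only [Polynomial.map_sub, Polynomial.map_pow, Polynomial.map_mul, Polynomial.map_X, Polynomial.map_ofNat,
    map_sub, map_pow, map_mul, aeval_X, map_ofNat] at hψ ⊢
  push_cast at hψ ⊢
  linear_combination ((2 : ↥(IntermediateField.adjoin ℚ ({β} : Set (AlgebraicClosure ℚ)))) * g ^ 3 - 7 * g ^ 2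
    + (57 / 8 : ↥(IntermediateField.adjoin ℚ ({β} : Set (AlgebraicClosure ℚ)))) * g - 1 / 4) * hψ

/-- `64 ∣ c_W(59)` for the `u`-cubic `c_W = u³ + 5u² − 64` of `307b1` (`c_W(59) = 222720 = 2⁹·435`): `e ≡ 59 (mod 64)` for the
odd `2`-adic root `e`. [cite: Serre1973, Ch. II §2.2] -/
theorem cubic_dvd_307b1 [((⟨1, 1, 0, 0, -1⟩ : WeierstrassCurve ℤ).baseChange ℚ).IsGloballyMinimal] :
    (2 : ℤ) ^ (3 + 3) ∣ (59 : ℤ) ^ 3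
      + (integralModelInt ((⟨1, 1, 0, 0, -1⟩ : WeierstrassCurve ℤ).baseChange ℚ)).b₂ * 59 ^ 2
      + 8 * (integralModelInt ((⟨1, 1, 0, 0, -1⟩ : WeierstrassCurve ℤ).baseChange ℚ)).b₄ * 59
      + 16 * (integralModelInt ((⟨1, 1, 0, 0, -1⟩ : WeierstrassCurve ℤ).baseChange ℚ)).b₆ := by
  rw [Literature.NumberTheory.EllipticCurves.integralModelInt_baseChange_int]
  decide

/-- The sign congruence `P(59)·1 = 3304 ≡ 2³·5 (mod 2⁶)` (`σ(ε₀) ≡ 5 (mod 8)`: the Hilbert symbol `(σ(ε₀), 2)₂ = −1`). [cite: Serre1973, Ch. III §1.2 Thm. 1] -/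
theorem signCert_307b1 :
    ((((X ^ 2 - 3 * X : ℤ[X])).eval 59 * 1 : ℤ) : ZMod (2 ^ (3 + 3))) = ((2 ^ 3 * 5 : ℤ) : ZMod (2 ^ (3 + 3))) := by
  simp only [eval_sub, eval_pow, eval_mul, eval_ofNat, eval_X]
  decide

/-! ## §4 THE ROW: `MC₂(307b1)` from PRINT + Creutz–Miller + `hYY` + MuIneqʳ + `r_an = 0` + one `L`-value bit -/

/-- **THE FIRST ROW OF THE CUBIC CHEVALLEY ROAD — `MazurMainConjecture 307b1 2`.** Displayed: PRINT⁵ {`h17` Kato 17.4 (1)(2) at `2` for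
`307b1`, `hGr` Greenberg 4.1, `hper` period unit, `hmod` modularity, `hGZK`} + `hCM` Creutz–Miller 2012 (gives `BSD(307b1,2)`) + `hYY`
(Brumer–Kramer / Yoo–Yu) + `hI` = MuIneqʳ (the registered stub of line `birth`, VERBATIM) + the certificate `r_an(307b1) = 0` + ONE table
datum «`L(307b1,1)/Ω = q` with `q ≠ 0`, `ord₂ q = 0`» (Cremona 1992 Table 4: `q = 1`). Every other binder of att-p5 g30's door
`…CubicChevalleyLValueBit.mazurMainConjecture_two_of_muIneqRel_of_lValue_unit_of_unitCerts_muFree` — ellipticity, minimality, good ordinary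
reduction at `2`, no rational `2`-torsion abscissa, `Δ < 0`, off the Kilford stratum, `∏ c_v` odd, a root `β ∈ ℚ̄` of the `2`-division cubic,
the unit `ε₀ = ((4β)² − 3(4β))/8` with its cubic equation (`T = 5`, `S = 19`, `sgn = −1`) and the `2`-adic certificate
(`a = 59`, `c = 5`, `64 ∣ c_W(59)`, `P(59) ≡ 40 (mod 64)`) — is decided by the kernel. CONDITIONAL; BSD is NOT proved; nothing closed.
[cite: CremonaAlgorithms1997, Table 1 and Table 4 (307 B)] [cite: CreutzMiller2012, Thm. 1.1] [cite: YooYu2022, Thm. 1.6 with Thm. 1.10 and 1.11]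
[cite: Kato2004Asterisque, Thm. 17.4 (1)(2) (p. 273)] [cite: GreenbergLNM1716, Thm. 4.1 (p. 102)] [cite: Miller2011LMS, Def. 1.1]
[cite: Fukuda1994, Thm. 1 (1), p. 264] [cite: Lang1990, Ch. 13 §4, Lemma 4.1] [cite: Serre1973, Ch. III §1.2 Thm. 1] -/
theorem mazurMainConjecture_two_307b1_of_lValue
    [((⟨1, 1, 0, 0, -1⟩ : WeierstrassCurve ℤ).baseChange ℚ).IsElliptic] [((⟨1, 1, 0, 0, -1⟩ : WeierstrassCurve ℤ).baseChange ℚ).IsGloballyMinimal]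
    (h17 : ∀ [NeZero (((⟨1, 1, 0, 0, -1⟩ : WeierstrassCurve ℤ).baseChange ℚ).conductorNorm ℤ)]
      (f : CuspForm (Gamma0 (((⟨1, 1, 0, 0, -1⟩ : WeierstrassCurve ℤ).baseChange ℚ).conductorNorm ℤ)) 2),
      kato_divisibility_allPrimes ((⟨1, 1, 0, 0, -1⟩ : WeierstrassCurve ℤ).baseChange ℚ) 2 (f := f))
    (hGr : Greenberg1999.thm41_charValue_rankZero_anyPrime)
    (hper : realPeriodRat_eq_unit_mul_plusPeriod_two) (hmod : nonempty_modularParametrizationData)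
    (hGZK : rank_eq_analyticRank_of_analyticRank_le_one)
    (hCM : bsdTriple_of_rank_le_one_of_conductor_lt)
    (hYY : yooYu_selmerTwo_eq_bot_oddClassNumber_cubicTwoTorsionField)
    (hI : ∀ (W : WeierstrassCurve ℚ) [W.IsElliptic] [W.IsGloballyMinimal], IsOrdinaryAt W 2 →
      (∀ x : ℚ, ¬ HasRationalTwoTorsionX W x) →
      ∀ (κ : ZpExtension ℚ 2) (γ : Field.absoluteGaloisGroup ℚ), κ.IsCyclotomic →
      κ.IsTopGenerator γ → IsCyclotomicVariable 2 γ →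
      ∀ ⦃N : ℕ⦄ [NeZero N] (f : CuspForm (Gamma0 N) 2), IsNewformOf W f →
      ∀ Gp : IwasawaAlgebra 2, iwasawaToPowerSeries 2 Gp = padicLFunction f (unitRoot W 2 : ℚ_[2]) →
      ∀ (D : W.SelmerDualData κ γ) (Yr : W.FineSelmerDualDataRelaxedInf κ γ),
        lengthAt (IwasawaAlgebra 2) D.X ⟨IwasawaAlgebra.augIdealP 2, IwasawaAlgebra.isPrime_augIdealP_holds 2⟩ ≤
          lengthAt (IwasawaAlgebra 2) (IwasawaAlgebra 2 ⧸ Ideal.span {Gp})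
              ⟨IwasawaAlgebra.augIdealP 2, IwasawaAlgebra.isPrime_augIdealP_holds 2⟩ +
            lengthAt (IwasawaAlgebra 2) Yr.X ⟨IwasawaAlgebra.augIdealP 2, IwasawaAlgebra.isPrime_augIdealP_holds 2⟩)
    (hr : ((⟨1, 1, 0, 0, -1⟩ : WeierstrassCurve ℤ).baseChange ℚ).analyticRank = 0)
    {q : ℚ} (hq0 : q ≠ 0) (hq : padicValRat 2 q = 0)
    (hL : ((⟨1, 1, 0, 0, -1⟩ : WeierstrassCurve ℤ).baseChange ℚ).entireLFunction 1 /
      ((((⟨1, 1, 0, 0, -1⟩ : WeierstrassCurve ℤ).baseChange ℚ).realPeriodRat : ℂ)) = (q : ℂ)) :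
    MazurMainConjecture ((⟨1, 1, 0, 0, -1⟩ : WeierstrassCurve ℤ).baseChange ℚ) 2 := by
  -- a root `β ∈ ℚ̄` of the `2`-division cubic `4x³ + 5x² − 4`
  have hdeg : ((⟨1, 1, 0, 0, -1⟩ : WeierstrassCurve ℤ).baseChange ℚ).twoTorsionPolynomial.toPoly.degree ≠ 0 := by
    rw [Cubic.degree_of_a_ne_zero (by simp [WeierstrassCurve.twoTorsionPolynomial])]; decide
  obtain ⟨β, hβ⟩ := IsAlgClosed.exists_aeval_eq_zero (AlgebraicClosure ℚ) _ hdeg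
  have hord : IsOrdinaryAt ((⟨1, 1, 0, 0, -1⟩ : WeierstrassCurve ℤ).baseChange ℚ) 2 := goodOrd_two_307b1
  exact mazurMainConjecture_two_of_muIneqRel_of_lValue_unit_of_unitCerts_muFree _ h17 hGr hper hmod hGZK hYY hI hord
    not_hasRationalTwoTorsionX_307b1 Δ_307b1_neg hr (bsdp_two_307b1_of_creutzMiller hCM hGZK hr) not_onKilfordStratumAtTwo_307b1
    odd_tamagawaProduct_307b1 ⟨q, hq0, hL, hq⟩ hβ (X ^ 2 - 3 * X) 3 1 1 59 5 5 19 (-1) (Or.inr rfl) (unit_eq_307b1 hβ)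
    (Or.inr rfl) ⟨29, by norm_num⟩ cubic_dvd_307b1 (by decide) signCert_307b1

/-- **THE ROW WITH CREMONA'S VALUE `L(307b1,1)/Ω = 1`** (Table 4, `307 B`: `r = 0`, `Ω = L(1) = 2.3490923578`, `S = 1`).
[cite: CremonaAlgorithms1997, Table 4 (307 B)] [cite: CreutzMiller2012, Thm. 1.1] [cite: YooYu2022, Thm. 1.6 with Thm. 1.10 and 1.11]
[cite: Kato2004Asterisque, Thm. 17.4 (1)(2) (p. 273)] [cite: GreenbergLNM1716, Thm. 4.1 (p. 102)] [cite: Miller2011LMS, Def. 1.1] -/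
theorem mazurMainConjecture_two_307b1_of_lValue_eq_one
    [((⟨1, 1, 0, 0, -1⟩ : WeierstrassCurve ℤ).baseChange ℚ).IsElliptic] [((⟨1, 1, 0, 0, -1⟩ : WeierstrassCurve ℤ).baseChange ℚ).IsGloballyMinimal]
    (h17 : ∀ [NeZero (((⟨1, 1, 0, 0, -1⟩ : WeierstrassCurve ℤ).baseChange ℚ).conductorNorm ℤ)]
      (f : CuspForm (Gamma0 (((⟨1, 1, 0, 0, -1⟩ : WeierstrassCurve ℤ).baseChange ℚ).conductorNorm ℤ)) 2),
      kato_divisibility_allPrimes ((⟨1, 1, 0, 0, -1⟩ : WeierstrassCurve ℤ).baseChange ℚ) 2 (f := f))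
    (hGr : Greenberg1999.thm41_charValue_rankZero_anyPrime)
    (hper : realPeriodRat_eq_unit_mul_plusPeriod_two) (hmod : nonempty_modularParametrizationData)
    (hGZK : rank_eq_analyticRank_of_analyticRank_le_one)
    (hCM : bsdTriple_of_rank_le_one_of_conductor_lt)
    (hYY : yooYu_selmerTwo_eq_bot_oddClassNumber_cubicTwoTorsionField)
    (hI : ∀ (W : WeierstrassCurve ℚ) [W.IsElliptic] [W.IsGloballyMinimal], IsOrdinaryAt W 2 →
      (∀ x : ℚ, ¬ HasRationalTwoTorsionX W x) →
      ∀ (κ : ZpExtension ℚ 2) (γ : Field.absoluteGaloisGroup ℚ), κ.IsCyclotomic →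
      κ.IsTopGenerator γ → IsCyclotomicVariable 2 γ →
      ∀ ⦃N : ℕ⦄ [NeZero N] (f : CuspForm (Gamma0 N) 2), IsNewformOf W f →
      ∀ Gp : IwasawaAlgebra 2, iwasawaToPowerSeries 2 Gp = padicLFunction f (unitRoot W 2 : ℚ_[2]) →
      ∀ (D : W.SelmerDualData κ γ) (Yr : W.FineSelmerDualDataRelaxedInf κ γ),
        lengthAt (IwasawaAlgebra 2) D.X ⟨IwasawaAlgebra.augIdealP 2, IwasawaAlgebra.isPrime_augIdealP_holds 2⟩ ≤
          lengthAt (IwasawaAlgebra 2) (IwasawaAlgebra 2 ⧸ Ideal.span {Gp})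
              ⟨IwasawaAlgebra.augIdealP 2, IwasawaAlgebra.isPrime_augIdealP_holds 2⟩ +
            lengthAt (IwasawaAlgebra 2) Yr.X ⟨IwasawaAlgebra.augIdealP 2, IwasawaAlgebra.isPrime_augIdealP_holds 2⟩)
    (hr : ((⟨1, 1, 0, 0, -1⟩ : WeierstrassCurve ℤ).baseChange ℚ).analyticRank = 0)
    (hL1 : ((⟨1, 1, 0, 0, -1⟩ : WeierstrassCurve ℤ).baseChange ℚ).entireLFunction 1 /
      ((((⟨1, 1, 0, 0, -1⟩ : WeierstrassCurve ℤ).baseChange ℚ).realPeriodRat : ℂ)) = ((1 : ℚ) : ℂ)) :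
    MazurMainConjecture ((⟨1, 1, 0, 0, -1⟩ : WeierstrassCurve ℤ).baseChange ℚ) 2 :=
  mazurMainConjecture_two_307b1_of_lValue h17 hGr hper hmod hGZK hCM hYY hI hr one_ne_zero (by simp) hL1

/-- **`μ₂ = 0` for the cyclotomic `ℤ₂`-extension of the cubic field of discriminant `−307`** (`= ℚ(β)`, `β` any root of
`4x³ + 5x² − 4` in `ℚ̄`), modulo `hYY` + Creutz–Miller + GZK + `r_an(307b1) = 0` + the datum «`L(307b1,1)/Ω = q`, `q ≠ 0`, `ord₂ q = 0`»:
att-p5 g30's `classicalMuVanishes_adjoin_of_lValue_unit_of_unitCerts_of_not_onKilfordStratumAtTwo` with every other binder kernel-decided.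
[cite: YooYu2022, Thm. 1.6 with Thm. 1.10 and 1.11] [cite: CreutzMiller2012, Thm. 1.1] [cite: Fukuda1994, Thm. 1 (1), p. 264]
[cite: Lang1990, Ch. 13 §4, Lemma 4.1] [cite: Serre1973, Ch. III §1.2 Thm. 1] -/
theorem classicalMuVanishes_cubicField_307b1_of_lValue
    (hYY : yooYu_selmerTwo_eq_bot_oddClassNumber_cubicTwoTorsionField)
    [((⟨1, 1, 0, 0, -1⟩ : WeierstrassCurve ℤ).baseChange ℚ).IsElliptic] [((⟨1, 1, 0, 0, -1⟩ : WeierstrassCurve ℤ).baseChange ℚ).IsGloballyMinimal]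
    (hCM : bsdTriple_of_rank_le_one_of_conductor_lt) (hGZK : rank_eq_analyticRank_of_analyticRank_le_one)
    (hr : ((⟨1, 1, 0, 0, -1⟩ : WeierstrassCurve ℤ).baseChange ℚ).analyticRank = 0)
    {q : ℚ} (hq0 : q ≠ 0) (hq : padicValRat 2 q = 0)
    (hL : ((⟨1, 1, 0, 0, -1⟩ : WeierstrassCurve ℤ).baseChange ℚ).entireLFunction 1 /
      ((((⟨1, 1, 0, 0, -1⟩ : WeierstrassCurve ℤ).baseChange ℚ).realPeriodRat : ℂ)) = (q : ℂ))
    {β : AlgebraicClosure ℚ}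
    (hβ : aeval β ((⟨1, 1, 0, 0, -1⟩ : WeierstrassCurve ℤ).baseChange ℚ).twoTorsionPolynomial.toPoly = 0)
    (κP : ZpExtension ↥(IntermediateField.adjoin ℚ ({β} : Set (AlgebraicClosure ℚ))) 2) (hκP : κP.IsCyclotomic) :
    ClassicalMuVanishes κP := by
  have hord : IsOrdinaryAt ((⟨1, 1, 0, 0, -1⟩ : WeierstrassCurve ℤ).baseChange ℚ) 2 := goodOrd_two_307b1
  exact classicalMuVanishes_adjoin_of_lValue_unit_of_unitCerts_of_not_onKilfordStratumAtTwo _ hYY hord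
    not_hasRationalTwoTorsionX_307b1 Δ_307b1_neg not_onKilfordStratumAtTwo_307b1 odd_tamagawaProduct_307b1 hr
    (bsdp_two_307b1_of_creutzMiller hCM hGZK hr) ⟨q, hq0, hL, hq⟩ hβ (X ^ 2 - 3 * X) 3 1 1 59 5 5 19 (-1) (Or.inr rfl)
    (unit_eq_307b1 hβ) (Or.inr rfl) ⟨29, by norm_num⟩ cubic_dvd_307b1 (by decide) signCert_307b1 κP hκP

end Summit.BirchSwinnertonDyer.BirchSwinnertonDyer.Theorems.AlignedTransportAtTwoCubicChevalleyRow307b1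

end
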